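import Literature.Computability.QuantumComplexity.GoldenCyclotomicArithmetic
import HarnessLib

/-!
# The exact braid compiler: definitions

Topic `Literature/Computability/QuantumComplexity`. The `PromiseBQP`-hardness of the Jones
polynomial at `k = 5` (Aharonov–Arad 2011, Thm. 3.1) needs, inside the Karp reduction, a
COMPILER: given a target one- or two-qubit gate and a precision `δ = 1/poly`, output a braid word
whose path-model image is `δ`-close to the target ("by the Solovay–Kitaev theorem", AA §3.3). The
reduction machine of this library runs the following deterministic procedure, all of whose
decisions are EXACT comparisons in `ℤ[φ][√τ]` (`ZPhiS.lt`) of traces of `2 × 2` matrices over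
`K5 = ℤ[φ][ζ₅][√τ]` — no numerical analysis is involved (`SU2ChordGeometry`: in `SU(2)`,
`‖A - B‖² = 2 - Re tr(A†B)`):

* `Cand Γ` — a word (operator order) with its `K5` matrix and the same for its inverse; `mul`,
  `inv`, `conj`, `gcomm` (group commutator), `pow`, `tr2 = 2 Re tr ∈ ℤ[φ][√τ]`;
* `towerStep`/`tower` — the commutator tower `c_{s+1} = [c_s, V c_s V⁻¹]` with `V` from a fixed
  net minimising the trace (`SU2CommutatorTower.chord_gcomm_best`: chords square up to factors
  `1/2 … 2`);
* `smallTest`, `findJ` — the rational certificates `θ(c) ≤ x` (via `cos x ≤ 1 - x²/2 + 5x⁴/96`) and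
  "`J` powers reach angle `(π/2)e`" (via `Re tr(c^J) ≤ 2 - 2.5 e²`);
* `levelStep`/`descend`/`initW` — the greedy descent: at scale `e`, candidates `V c^{±j} V⁻¹`
  (`V ∈ net`, `j ≤ J`) and the new approximation `X W` with `X` maximising an exact SCORE that is a
  positive multiple of `Re tr(T† ·)` (`SU2GreedyDescent`: the error follows the schedule `e_t`).

Correctness is proved in the sequel from the `SU2*` geometry files; here only definitions and
their algebraic bookkeeping (`mat_mul`, `mat_pow`, word/inverse invariants).

## References

* D. Aharonov, I. Arad, New J. Phys. 13 (2011) 035019, §3.3 [AharonovArad2011].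
* C. M. Dawson, M. A. Nielsen, QIC 6 (2006), §3–§4 [DawsonNielsen2006].
-/

namespace Literature.Computability.QuantumComplexity

open Matrix QuadraticAlgebra

namespace ExactCompiler

variable {Γ : Type}

/-- **A candidate**: a word in the generators (operator order: leftmost letter acts last) with its
exact `K5` matrix, and a word for the inverse with its matrix. [cite: AharonovArad2011, §3.3] -/
structure Cand (Γ : Type) where
  /-- the word, operator order -/
  word : List Γ
  /-- its matrix -/
  mat : Matrix (Fin 2) (Fin 2) K5
  /-- a word for the inverse -/
  iword : List Γ
  /-- the matrix of the inverse word -/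
  imat : Matrix (Fin 2) (Fin 2) K5

namespace Cand

/-- The empty word. [folklore] -/
def one : Cand Γ := ⟨[], 1, [], 1⟩

/-- Product (concatenation; matrices multiply, inverse words concatenate in reverse order). [folklore] -/
def mul (a b : Cand Γ) : Cand Γ := ⟨a.word ++ b.word, a.mat * b.mat, b.iword ++ a.iword, b.imat * a.imat⟩

/-- Inverse (swap the two halves). [folklore] -/
def inv (a : Cand Γ) : Cand Γ := ⟨a.iword, a.imat, a.word, a.mat⟩

/-- Conjugate `V c V⁻¹`. [folklore] -/
def conj (V c : Cand Γ) : Cand Γ := (V.mul c).mul V.inv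

/-- Group commutator `[a, b] = a b a⁻¹ b⁻¹`. [folklore] -/
def gcomm (a b : Cand Γ) : Cand Γ := (((a.mul b).mul a.inv)).mul b.inv

/-- Powers. [folklore] -/
def pow (c : Cand Γ) : ℕ → Cand Γ
  | 0 => one
  | n + 1 => (pow c n).mul c

/-- `2 Re tr ∈ ℤ[φ][√τ]` (exact). [folklore] -/
def tr2 (a : Cand Γ) : ZPhiS := K5.re2 (a.mat 0 0 + a.mat 1 1)

/-- Bookkeeping. [folklore] -/
@[simp] theorem mat_one : (one : Cand Γ).mat = 1 := rfl
/-- Bookkeeping. [folklore] -/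
@[simp] theorem imat_one : (one : Cand Γ).imat = 1 := rfl
/-- Bookkeeping. [folklore] -/
@[simp] theorem word_one : (one : Cand Γ).word = [] := rfl
/-- Bookkeeping. [folklore] -/
@[simp] theorem iword_one : (one : Cand Γ).iword = [] := rfl
/-- Bookkeeping. [folklore] -/
@[simp] theorem mat_mul (a b : Cand Γ) : (a.mul b).mat = a.mat * b.mat := rfl
/-- Bookkeeping. [folklore] -/
@[simp] theorem imat_mul (a b : Cand Γ) : (a.mul b).imat = b.imat * a.imat := rfl
/-- Bookkeeping. [folklore] -/
@[simp] theorem word_mul (a b : Cand Γ) : (a.mul b).word = a.word ++ b.word := rfl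
/-- Bookkeeping. [folklore] -/
@[simp] theorem iword_mul (a b : Cand Γ) : (a.mul b).iword = b.iword ++ a.iword := rfl
/-- Bookkeeping. [folklore] -/
@[simp] theorem mat_inv (a : Cand Γ) : a.inv.mat = a.imat := rfl
/-- Bookkeeping. [folklore] -/
@[simp] theorem imat_inv (a : Cand Γ) : a.inv.imat = a.mat := rfl
/-- Bookkeeping. [folklore] -/
@[simp] theorem word_inv (a : Cand Γ) : a.inv.word = a.iword := rfl
/-- Bookkeeping. [folklore] -/
@[simp] theorem iword_inv (a : Cand Γ) : a.inv.iword = a.word := rfl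

/-- **Well-formedness**: the matrices are the matrices of the words and inverse to each other.
[folklore] -/
structure WF (mat₀ : Γ → Matrix (Fin 2) (Fin 2) K5) (a : Cand Γ) : Prop where
  mat_eq : a.mat = (a.word.map mat₀).prod
  imat_eq : a.imat = (a.iword.map mat₀).prod
  mul_inv : a.mat * a.imat = 1
  inv_mul : a.imat * a.mat = 1

variable {mat₀ : Γ → Matrix (Fin 2) (Fin 2) K5}

/-- Bookkeeping. [folklore] -/
theorem WF.one : WF mat₀ (one : Cand Γ) := ⟨by simp, by simp, by simp, by simp⟩

/-- Bookkeeping. [folklore] -/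
theorem WF.mul {a b : Cand Γ} (ha : WF mat₀ a) (hb : WF mat₀ b) : WF mat₀ (a.mul b) := by
  refine ⟨?_, ?_, ?_, ?_⟩
  · rw [mat_mul, word_mul, List.map_append, List.prod_append, ha.mat_eq, hb.mat_eq]
  · rw [imat_mul, iword_mul, List.map_append, List.prod_append, ha.imat_eq, hb.imat_eq]
  · rw [mat_mul, imat_mul, Matrix.mul_assoc, ← Matrix.mul_assoc b.mat, hb.mul_inv, Matrix.one_mul, ha.mul_inv]
  · rw [mat_mul, imat_mul, Matrix.mul_assoc, ← Matrix.mul_assoc a.imat, ha.inv_mul, Matrix.one_mul, hb.inv_mul]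

/-- Bookkeeping. [folklore] -/
theorem WF.inv {a : Cand Γ} (ha : WF mat₀ a) : WF mat₀ a.inv := ⟨ha.imat_eq, ha.mat_eq, ha.inv_mul, ha.mul_inv⟩

/-- Bookkeeping. [folklore] -/
theorem WF.conj {V c : Cand Γ} (hV : WF mat₀ V) (hc : WF mat₀ c) : WF mat₀ (V.conj c) := (hV.mul hc).mul hV.inv

/-- Bookkeeping. [folklore] -/
theorem WF.gcomm {a b : Cand Γ} (ha : WF mat₀ a) (hb : WF mat₀ b) : WF mat₀ (a.gcomm b) :=
  ((ha.mul hb).mul ha.inv).mul hb.inv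

/-- Bookkeeping. [folklore] -/
theorem WF.pow {c : Cand Γ} (hc : WF mat₀ c) : ∀ n, WF mat₀ (c.pow n)
  | 0 => WF.one
  | n + 1 => (WF.pow hc n).mul hc

/-- Bookkeeping. [folklore] -/
theorem mat_pow (c : Cand Γ) : ∀ n, (c.pow n).mat = c.mat ^ n
  | 0 => by simp [pow]
  | n + 1 => by rw [pow, mat_mul, mat_pow c n, pow_succ]

end Cand

/-! ### Selection by an exact key -/

/-- The element of `l` (or the default `d`) with the best key, scanning left to right and
replacing the incumbent when `better (key x) (key incumbent)`. [folklore] -/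
def bestBy {α : Type} (better : ZPhiS → ZPhiS → Bool) (key : α → ZPhiS) (d : α) (l : List α) : α :=
  l.foldl (fun b x => if better (key x) (key b) then x else b) d

/-- `bestBy` returns the default or a member of the list. [folklore] -/
theorem bestBy_mem {α : Type} (better : ZPhiS → ZPhiS → Bool) (key : α → ZPhiS) (d : α) (l : List α) :
    bestBy better key d l = d ∨ bestBy better key d l ∈ l := by
  unfold bestBy
  induction l generalizing d with
  | nil => simp
  | cons x l ih =>
    rw [List.foldl_cons]
    rcases ih (if better (key x) (key d) then x else d) with h | h
    · rw [h]; split_ifs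
      · exact Or.inr (by simp)
      · exact Or.inl rfl
    · exact Or.inr (List.mem_cons_of_mem _ h)

/-- **Minimisation**: with `better = (<)` on the real values, the result's key is `≤` every key in
the list and `≤` the default's. [folklore] -/
theorem toReal_key_bestBy_le {α : Type} (key : α → ZPhiS) (d : α) (l : List α) :
    ZPhiS.toReal (key (bestBy ZPhiS.lt key d l)) ≤ ZPhiS.toReal (key d) ∧
      ∀ x ∈ l, ZPhiS.toReal (key (bestBy ZPhiS.lt key d l)) ≤ ZPhiS.toReal (key x) := by
  unfold bestBy
  induction l generalizing d with
  | nil => simp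
  | cons x l ih =>
    rw [List.foldl_cons]
    set d' := (if ZPhiS.lt (key x) (key d) then x else d) with hd'
    obtain ⟨h1, h2⟩ := ih d'
    have hd'x : ZPhiS.toReal (key d') ≤ ZPhiS.toReal (key x) ∧ ZPhiS.toReal (key d') ≤ ZPhiS.toReal (key d) := by
      rw [hd']
      by_cases h : ZPhiS.lt (key x) (key d) = true
      · rw [if_pos h]; exact ⟨le_rfl, le_of_lt ((ZPhiS.lt_iff _ _).1 h)⟩
      · rw [if_neg h]
        have : ¬ ZPhiS.toReal (key x) < ZPhiS.toReal (key d) := fun h' => h ((ZPhiS.lt_iff _ _).2 h')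
        exact ⟨not_lt.1 this, le_rfl⟩
    refine ⟨h1.trans hd'x.2, fun y hy => ?_⟩
    rcases List.mem_cons.1 hy with rfl | hy
    · exact h1.trans hd'x.1
    · exact h2 y hy

/-- **Maximisation**: with `better a b = (b < a)`, the result's key is `≥` every key in the list.
[folklore] -/
theorem le_toReal_key_bestBy {α : Type} (key : α → ZPhiS) (d : α) (l : List α) :
    ZPhiS.toReal (key d) ≤ ZPhiS.toReal (key (bestBy (fun a b => ZPhiS.lt b a) key d l)) ∧
      ∀ x ∈ l, ZPhiS.toReal (key x) ≤ ZPhiS.toReal (key (bestBy (fun a b => ZPhiS.lt b a) key d l)) := by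
  unfold bestBy
  induction l generalizing d with
  | nil => simp
  | cons x l ih =>
    rw [List.foldl_cons]
    set d' := (if ZPhiS.lt (key d) (key x) then x else d) with hd'
    obtain ⟨h1, h2⟩ := ih d'
    have hd'x : ZPhiS.toReal (key x) ≤ ZPhiS.toReal (key d') ∧ ZPhiS.toReal (key d) ≤ ZPhiS.toReal (key d') := by
      rw [hd']
      by_cases h : ZPhiS.lt (key d) (key x) = true
      · rw [if_pos h]; exact ⟨le_rfl, le_of_lt ((ZPhiS.lt_iff _ _).1 h)⟩
      · rw [if_neg h]
        have : ¬ ZPhiS.toReal (key d) < ZPhiS.toReal (key x) := fun h' => h ((ZPhiS.lt_iff _ _).2 h')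
        exact ⟨not_lt.1 this, le_rfl⟩
    refine ⟨hd'x.2.trans h1, fun y hy => ?_⟩
    rcases List.mem_cons.1 hy with rfl | hy
    · exact hd'x.1.trans h1
    · exact h2 y hy

/-! ### The commutator tower -/

/-- **One level of the tower**: among `[c, V c V⁻¹]`, `V ∈ net`, the one of least trace (largest
chord). [cite: AharonovArad2011, §3.3] [cite: DawsonNielsen2006, §4.1] -/
def towerStep (net : List (Cand Γ)) (c : Cand Γ) : Cand Γ :=
  let cands := net.map fun V => c.gcomm (V.conj c)
  bestBy ZPhiS.lt Cand.tr2 (cands.headD c) cands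

/-- **The tower** `c₀, c₁, …, c_S` (a list of `S + 1` levels). [cite: AharonovArad2011, §3.3] -/
def tower (net : List (Cand Γ)) (c₀ : Cand Γ) : ℕ → List (Cand Γ)
  | 0 => [c₀]
  | S + 1 => let L := tower net c₀ S; L ++ [towerStep net (L.getLastD c₀)]

/-! ### Rational certificates -/

/-- Integers as elements of `ℤ[φ][√τ]`. [folklore] -/
def zphis (n : ℤ) : ZPhiS := ⟨⟨n, 0⟩, 0⟩

/-- **Certificate `θ(c) ≤ p/q`**: `2Re tr c ≥ 4(1 - x²/2 + 5x⁴/96)` with `x = p/q`, cleared of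
denominators: `24 q⁴ · tr2 ≥ 96 q⁴ - 48 p² q² + 5 p⁴`. [folklore] -/
def smallTest (p q : ℕ) (c : Cand Γ) : Bool :=
  !(ZPhiS.lt (zphis (24 * (q : ℤ) ^ 4) * c.tr2) (zphis (96 * (q : ℤ) ^ 4 - 48 * (p : ℤ) ^ 2 * (q : ℤ) ^ 2 + 5 * (p : ℤ) ^ 4)))

/-- **Certificate "the power reaches angle `(π/2)·(p/q)`"**: `2Re tr(c^j) ≤ 4 - 5 (p/q)²`, i.e.
`q² · tr2(c^j) ≤ 4 q² - 5 p²`. [folklore] -/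
def reachTest (p q : ℕ) (cj : Cand Γ) : Bool :=
  !(ZPhiS.lt (zphis (4 * (q : ℤ) ^ 2 - 5 * (p : ℤ) ^ 2)) (zphis ((q : ℤ) ^ 2) * cj.tr2))

/-- **`J`**: the least `j ∈ {1, …, Jmax}` whose power passes `reachTest`, else `Jmax`. [folklore] -/
def findJ (p q Jmax : ℕ) (c : Cand Γ) : ℕ :=
  (((List.range Jmax).map (· + 1)).find? fun j => reachTest p q (c.pow j)).getD Jmax

/-! ### The greedy descent -/

/-- The candidates at a level: `V c^{j} V⁻¹` and `V c^{-j} V⁻¹`, `V ∈ net`, `j ≤ J`. [cite: AharonovArad2011, §3.3] -/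
def levelCands (net : List (Cand Γ)) (c : Cand Γ) (J : ℕ) : List (Cand Γ) :=
  net.flatMap fun V => (List.range (J + 1)).flatMap fun j => [V.conj (c.pow j), V.conj (c.inv.pow j)]

/-- **One level of the descent** at scale `e = p/q`: pick the first tower element certified to have
`θ ≤ e/16`, the number of powers `J`, and the score-maximising candidate `X`; return `X W`.
[cite: AharonovArad2011, §3.3] -/
def levelStep (net towerL : List (Cand Γ)) (score : Matrix (Fin 2) (Fin 2) K5 → ZPhiS) (p q Jmax : ℕ) (W : Cand Γ) :
    Cand Γ :=
  let c := (towerL.find? (smallTest p (16 * q))).getD (towerL.getLastD Cand.one)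
  let J := findJ p q Jmax c
  let cands := levelCands net c J
  let X := bestBy (fun a b => ZPhiS.lt b a) (fun X => score (X.mat * W.mat)) (cands.headD Cand.one) cands
  X.mul W

/-- **The initial approximation**: the score-maximising element of the net. [cite: AharonovArad2011, §3.3] -/
def initW (net : List (Cand Γ)) (score : Matrix (Fin 2) (Fin 2) K5 → ZPhiS) : Cand Γ :=
  bestBy (fun a b => ZPhiS.lt b a) (fun X => score X.mat) (net.headD Cand.one) net

/-- **The descent** along a schedule of scales `(p_t, q_t, Jmax_t)`. [cite: AharonovArad2011, §3.3] -/
def descend (net towerL : List (Cand Γ)) (score : Matrix (Fin 2) (Fin 2) K5 → ZPhiS) (schedule : List (ℕ × ℕ × ℕ))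
    (W₀ : Cand Γ) : Cand Γ :=
  schedule.foldl (fun W s => levelStep net towerL score s.1 s.2.1 s.2.2 W) W₀

/-- **The compiler**: tower of depth `S`, then descent from the best net element.
[cite: AharonovArad2011, §3.3] -/
def compile (net : List (Cand Γ)) (c₀ : Cand Γ) (S : ℕ) (score : Matrix (Fin 2) (Fin 2) K5 → ZPhiS)
    (schedule : List (ℕ × ℕ × ℕ)) : Cand Γ :=
  descend net (tower net c₀ S) score schedule (initW net score)

end ExactCompiler

end Literature.Computability.QuantumComplexity
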